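import Literature.RingTheory.FormalGroups.FormalOModuleLaw
import Literature.RingTheory.FormalGroups.DegreeCongruence
import HarnessLib

/-!
# Buds of formal `𝒪`-module laws: formal `𝒪`-module laws modulo degree `m + 1`
# ([Lazard 1955] §II «bourgeons»; [Drinfeld 1974] §1; [Hazewinkel 1978] §5.7, §21.1)

Topic `Literature/RingTheory/FormalGroups`; namespace `Literature.RingTheory.FormalGroups`.  DEFINITIONS (the defect series and
the structure `IsOModuleBud`) + fully proved theorems; no named fact, no instance, no notation, no `sorry`.  Cell
`hodgecm-mathlib`, P6 «MOD programme», sub-line P6d, first file of the power-series layer for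
`stub_L4B3cO` (formal `𝒪`-module laws lift along surjections, Drinfeld's road).

An **`m`-bud** (Lazard: «`m`-bourgeon») of formal `𝒪`-module laws over an `𝒪`-algebra `B` is a pair `(F, ρ)`,
`F ∈ B⟦X₀,X₁⟧`, `ρ : 𝒪 → B⟦X⟧`, with `F ≡ X₀ + X₁`, `ρ_a ≡ a·X (mod deg 2)` and no constant terms, satisfying the axioms of a
formal `𝒪`-module law MODULO TOTAL DEGREE `m + 1`: associativity, commutativity, `ρ_a ∘ F = F ∘ (ρ_a × ρ_a)`,
`ρ_{a+b} = F(ρ_a, ρ_b)`, `ρ_{ab} = ρ_a ∘ ρ_b`, `ρ_1 = X`, `ρ_0 = 0`.  Congruences `mod deg N` are spelt, as in the sibling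
`DegreeCongruence` (Lazard's Lemme 1), `↑N ≤ (lhs − rhs).order`; substitution is Mathlib's `MvPowerSeries.subst` ∕
`PowerSeries.subst`; the shapes of the seven defects are those of Mathlib's `FormalGroup.assoc` ∕ `FormalGroup.IsComm`, of ★
`FormalGroupHom.map_add` and of ★ `FormalOModuleLaw.act_add` ∕ `act_mul` ∕ `act_one` ∕ `act_zero`, so that an exact formal
`𝒪`-module law (★ `FormalOModuleLaw`) is an `m`-bud for every `m` (`FormalOModuleLaw.isOModuleBud`) and conversely
(assembly file).

* `assocDefect F`, `commDefect F`, `homDefect F φ`, `addDefect F φ ψ χ`, `mulDefect φ ψ χ` — the defect series.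
* `IsOModuleBud 𝒪 m F ρ` — the structure; `IsOModuleBud.mono` (an `m`-bud is a `k`-bud for `k ≤ m`).
* `FormalOModuleLaw.isOModuleBud` — exact laws are buds of every order; in particular the ADDITIVE bud
  `(X₀ + X₁, a ↦ a·X)` (`isOModuleBud_additive`).
* `IsOModuleBud.map` — base change along `𝒪`-algebra maps; `IsOModuleBud.of_map_injective` — bud-ness descends along
  injective base change.
* `IsOModuleBud.congr` — bud-ness is invariant under congruence `mod deg m+1` of the data (Lazard's Lemme 1).

Deliberately NOT here: the variation of the defects under a perturbation of order `≥ m` (sibling `FormalOModuleBudVariation`),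
extension and lifting of buds (siblings), heights.
-/

noncomputable section

namespace Literature.RingTheory.FormalGroups

open MvPowerSeries (HasSubst subst X order)

universe u v w

variable (𝒪 : Type u) [CommRing 𝒪] {B : Type v} [CommRing B] [Algebra 𝒪 B] {B' : Type w} [CommRing B'] [Algebra 𝒪 B']

/-! ## §1 Defect series -/

/-- The **associativity defect** `F(F(Y₀,Y₁),Y₂) − F(Y₀,F(Y₁,Y₂))` (shape of Mathlib's `FormalGroup.assoc`).
[cite: Lazard1955, §II (bourgeons)] -/
def assocDefect (F : MvPowerSeries (Fin 2) B) : MvPowerSeries (Fin 3) B :=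
  F.subst ![F.subst ![X 0, X 1], X 2] - F.subst ![X 0, F.subst ![X 1, X 2]]

/-- The **commutativity defect** `F(X₀,X₁) − F(X₁,X₀)` (shape of Mathlib's `FormalGroup.IsComm`). [cite: Lazard1955, §II (bourgeons)] -/
def commDefect (F : MvPowerSeries (Fin 2) B) : MvPowerSeries (Fin 2) B :=
  F - F.subst ![X 1, X 0]

/-- The **homomorphism defect** `φ(F(X₀,X₁)) − F(φ(X₀), φ(X₁))` of a series `φ` w.r.t. `F` (shape of ★ `FormalGroupHom.map_add`).
[cite: Hazewinkel1978, §21.1 Def. (21.1.1)] -/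
def homDefect (F : MvPowerSeries (Fin 2) B) (φ : PowerSeries B) : MvPowerSeries (Fin 2) B :=
  PowerSeries.subst F φ - F.subst ![PowerSeries.subst (X 0 : MvPowerSeries (Fin 2) B) φ, PowerSeries.subst (X 1) φ]

/-- The **additivity defect** `χ − F(φ, ψ)` (for `χ = ρ_{a+b}`, `φ = ρ_a`, `ψ = ρ_b`; shape of ★ `FormalOModuleLaw.act_add`).
[cite: Hazewinkel1978, §21.1 Def. (21.1.1)] -/
def addDefect (F : MvPowerSeries (Fin 2) B) (φ ψ χ : PowerSeries B) : PowerSeries B :=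
  χ - F.subst ![(φ : MvPowerSeries Unit B), ψ]

/-- The **multiplicativity defect** `χ − φ(ψ)` (for `χ = ρ_{ab}`, `φ = ρ_a`, `ψ = ρ_b`; shape of ★ `FormalOModuleLaw.act_mul`).
[cite: Hazewinkel1978, §21.1 Def. (21.1.1)] -/
def mulDefect (φ ψ χ : PowerSeries B) : PowerSeries B :=
  χ - PowerSeries.subst ψ φ

/-! ## §2 Buds -/

/-- **`m`-bud of formal `𝒪`-module laws** over the `𝒪`-algebra `B` (Lazard's «bourgeon», with `𝒪`-action): `F ≡ X₀ + X₁`,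
`ρ_a ≡ a·X (mod deg 2)`, no constant terms, and the seven axioms of a formal `𝒪`-module law modulo total degree `m + 1`.
[cite: Lazard1955, §II (bourgeons)] [cite: Drinfeld1974, §1 Def.] [cite: Hazewinkel1978, §21.1 Def. (21.1.1)] -/
structure IsOModuleBud (m : ℕ) (F : MvPowerSeries (Fin 2) B) (ρ : 𝒪 → PowerSeries B) : Prop where
  /-- `F(0,0) = 0` -/
  constantCoeff_F : MvPowerSeries.constantCoeff F = 0
  /-- `F ≡ X₀ + X₁ (mod deg 2)` -/
  two_le_order_F : ((2 : ℕ) : ℕ∞) ≤ (F - X 0 - X 1).order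
  /-- `ρ_a(0) = 0` -/
  constantCoeff_ρ : ∀ a, PowerSeries.constantCoeff (ρ a) = 0
  /-- `ρ_a ≡ a·X (mod deg 2)` -/
  coeff_one_ρ : ∀ a, PowerSeries.coeff 1 (ρ a) = algebraMap 𝒪 B a
  /-- associativity `mod deg m+1` -/
  assoc : ((m + 1 : ℕ) : ℕ∞) ≤ (assocDefect F).order
  /-- commutativity `mod deg m+1` -/
  comm : ((m + 1 : ℕ) : ℕ∞) ≤ (commDefect F).order
  /-- `ρ_a` is an endomorphism `mod deg m+1` -/
  hom : ∀ a, ((m + 1 : ℕ) : ℕ∞) ≤ (homDefect F (ρ a)).order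
  /-- `ρ_{a+b} = F(ρ_a, ρ_b)` `mod deg m+1` -/
  add : ∀ a b, ((m + 1 : ℕ) : ℕ∞) ≤ MvPowerSeries.order (addDefect F (ρ a) (ρ b) (ρ (a + b)))
  /-- `ρ_{ab} = ρ_a ∘ ρ_b` `mod deg m+1` -/
  mul : ∀ a b, ((m + 1 : ℕ) : ℕ∞) ≤ MvPowerSeries.order (mulDefect (ρ a) (ρ b) (ρ (a * b)))
  /-- `ρ_1 = X` `mod deg m+1` -/
  one : ((m + 1 : ℕ) : ℕ∞) ≤ MvPowerSeries.order (ρ 1 - PowerSeries.X)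
  /-- `ρ_0 = 0` `mod deg m+1` -/
  zero : ((m + 1 : ℕ) : ℕ∞) ≤ MvPowerSeries.order (ρ 0)

variable {𝒪}

namespace IsOModuleBud

variable {m : ℕ} {F : MvPowerSeries (Fin 2) B} {ρ : 𝒪 → PowerSeries B}

/-- An `m`-bud is a `k`-bud for `k ≤ m`. [cite: Lazard1955, §II (bourgeons)] -/
theorem mono (h : IsOModuleBud 𝒪 m F ρ) {k : ℕ} (hk : k ≤ m) : IsOModuleBud 𝒪 k F ρ where
  constantCoeff_F := h.constantCoeff_F
  two_le_order_F := h.two_le_order_F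
  constantCoeff_ρ := h.constantCoeff_ρ
  coeff_one_ρ := h.coeff_one_ρ
  assoc := natCast_le_order_of_le h.assoc (by omega)
  comm := natCast_le_order_of_le h.comm (by omega)
  hom := fun a => natCast_le_order_of_le (h.hom a) (by omega)
  add := fun a b => natCast_le_order_of_le (h.add a b) (by omega)
  mul := fun a b => natCast_le_order_of_le (h.mul a b) (by omega)
  one := natCast_le_order_of_le h.one (by omega)
  zero := natCast_le_order_of_le h.zero (by omega)

/-- The arguments `ρ_a` are substitutable. [cite: Lazard1955, §II (bourgeons)] -/
theorem hasSubst_ρ (h : IsOModuleBud 𝒪 m F ρ) (a : 𝒪) : PowerSeries.HasSubst (ρ a) :=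
  PowerSeries.HasSubst.of_constantCoeff_zero' (h.constantCoeff_ρ a)

/-- `F` is substitutable as a univariate argument. [cite: Lazard1955, §II (bourgeons)] -/
theorem hasSubst_F (h : IsOModuleBud 𝒪 m F ρ) : PowerSeries.HasSubst F :=
  PowerSeries.HasSubst.of_constantCoeff_zero h.constantCoeff_F

/-- `ρ_a ≡ a·X (mod deg 2)` in order form. [cite: Lazard1955, §II (bourgeons)] -/
theorem two_le_order_ρ (h : IsOModuleBud 𝒪 m F ρ) (a : 𝒪) :
    ((2 : ℕ) : ℕ∞) ≤ MvPowerSeries.order (ρ a - algebraMap 𝒪 B a • PowerSeries.X) := by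
  refine natCast_le_order_of_coeff_eq_zero fun i hi => ?_
  have hi' : i = 0 ∨ i = 1 := by omega
  rcases hi' with rfl | rfl
  · simp [h.constantCoeff_ρ a]
  · simp [h.coeff_one_ρ a, PowerSeries.coeff_one_X, Algebra.algebraMap_eq_smul_one]

end IsOModuleBud

/-! ## §3 Exact laws are buds of every order -/

/-- **A formal `𝒪`-module law is an `m`-bud for every `m`** (all seven defects vanish identically).
[cite: Drinfeld1974, §1 Def.] [cite: Hazewinkel1978, §21.1 Def. (21.1.1)] -/
theorem FormalOModuleLaw.isOModuleBud (M : FormalOModuleLaw 𝒪 B) (m : ℕ) :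
    IsOModuleBud 𝒪 m M.toFormalGroup.toPowerSeries (fun a => (M.act a).toPowerSeries) where
  constantCoeff_F := M.toFormalGroup.zero_constantCoeff
  two_le_order_F := formalGroup_two_le_order_sub_X_sub_X M.toFormalGroup
  constantCoeff_ρ := fun a => (M.act a).constantCoeff_eq_zero
  coeff_one_ρ := M.coeff_one_act
  assoc := by
    have : assocDefect M.toFormalGroup.toPowerSeries = 0 := sub_eq_zero.2 M.toFormalGroup.assoc
    rw [this, MvPowerSeries.order_zero]; exact le_top
  comm := by
    haveI := M.isComm
    have : commDefect M.toFormalGroup.toPowerSeries = 0 := by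
      rw [commDefect, sub_eq_zero]
      exact FormalGroup.IsComm.comm (F := M.toFormalGroup)
    rw [this, MvPowerSeries.order_zero]; exact le_top
  hom := fun a => by
    have : homDefect M.toFormalGroup.toPowerSeries (M.act a).toPowerSeries = 0 := sub_eq_zero.2 (M.act a).map_add
    rw [this, MvPowerSeries.order_zero]; exact le_top
  add := fun a b => by
    have : addDefect M.toFormalGroup.toPowerSeries (M.act a).toPowerSeries (M.act b).toPowerSeries
        (M.act (a + b)).toPowerSeries = 0 := sub_eq_zero.2 (M.act_add a b)
    rw [this, MvPowerSeries.order_zero]; exact le_top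
  mul := fun a b => by
    have : mulDefect (M.act a).toPowerSeries (M.act b).toPowerSeries (M.act (a * b)).toPowerSeries = 0 :=
      sub_eq_zero.2 (M.act_mul a b)
    rw [this, MvPowerSeries.order_zero]; exact le_top
  one := by rw [M.act_one, sub_self, MvPowerSeries.order_zero]; exact le_top
  zero := by rw [M.act_zero, MvPowerSeries.order_zero]; exact le_top

variable (𝒪 B) in
/-- **The additive bud**: `(X₀ + X₁, a ↦ a·X)` is an `m`-bud for every `m` (it is the exact additive formal `𝒪`-module law
★ `FormalOModuleLaw.additive`). [cite: Hazewinkel1978, §21.1 Ex. (21.1.2)] -/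
theorem isOModuleBud_additive (m : ℕ) :
    IsOModuleBud 𝒪 m (X 0 + X 1 : MvPowerSeries (Fin 2) B) (fun a => algebraMap 𝒪 B a • PowerSeries.X) := by
  have h := (FormalOModuleLaw.additive 𝒪 B).isOModuleBud m
  exact h

/-! ## §4 Base change -/

section Map

variable {m : ℕ} {F : MvPowerSeries (Fin 2) B} {ρ : 𝒪 → PowerSeries B}

/-- `map f` applied entrywise to a `2`-vector of series (private plumbing). [folklore] -/
private theorem map_vec2 (f : B →+* B') {τ : Type*} (a b : MvPowerSeries τ B) :
    (fun i => MvPowerSeries.map f ((![a, b] : Fin 2 → MvPowerSeries τ B) i)) =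
      ![MvPowerSeries.map f a, MvPowerSeries.map f b] := by
  funext i; fin_cases i <;> simp

/-- Base change of the associativity defect. [cite: Hazewinkel1978, §1.1 (1.1.6)] -/
theorem map_assocDefect (f : B →+* B') (hF : MvPowerSeries.constantCoeff F = 0) :
    MvPowerSeries.map f (assocDefect F) = assocDefect (MvPowerSeries.map f F) := by
  have h01 : HasSubst (![X 0, X 1] : Fin 2 → MvPowerSeries (Fin 3) B) := HasSubst.X_X
  have h12 : HasSubst (![X 1, X 2] : Fin 2 → MvPowerSeries (Fin 3) B) := HasSubst.X_X
  have hl := HasSubst.cons_subst_zero_left (f := F) (0 : Fin 3) 1 2 hF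
  have hr := HasSubst.cons_subst_zero_right (f := F) (0 : Fin 3) 1 2 hF
  rw [assocDefect, assocDefect, map_sub, MvPowerSeries.map_subst hl, MvPowerSeries.map_subst hr, map_vec2, map_vec2,
    MvPowerSeries.map_subst h01, MvPowerSeries.map_subst h12, map_vec2, map_vec2]
  simp only [MvPowerSeries.map_X]

/-- Base change of the commutativity defect. [cite: Hazewinkel1978, §1.1 (1.1.6)] -/
theorem map_commDefect (f : B →+* B') :
    MvPowerSeries.map f (commDefect F) = commDefect (MvPowerSeries.map f F) := by
  rw [commDefect, commDefect, map_sub, MvPowerSeries.map_subst HasSubst.X_X, map_vec2]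
  simp only [MvPowerSeries.map_X]

/-- Base change of the homomorphism defect. [cite: Hazewinkel1978, §1.1 (1.1.6)] -/
theorem map_homDefect (f : B →+* B') (hF : MvPowerSeries.constantCoeff F = 0) {φ : PowerSeries B}
    (hφ : PowerSeries.constantCoeff φ = 0) :
    MvPowerSeries.map f (homDefect F φ) = homDefect (MvPowerSeries.map f F) (PowerSeries.map f φ) := by
  have hFs : PowerSeries.HasSubst F := PowerSeries.HasSubst.of_constantCoeff_zero hF
  have h0 : PowerSeries.HasSubst (X 0 : MvPowerSeries (Fin 2) B) := PowerSeries.HasSubst.X 0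
  have h1 : PowerSeries.HasSubst (X 1 : MvPowerSeries (Fin 2) B) := PowerSeries.HasSubst.X 1
  have hpair : HasSubst ![PowerSeries.subst (X 0 : MvPowerSeries (Fin 2) B) φ, PowerSeries.subst (X 1) φ] :=
    MvPowerSeries.hasSubst_of_constantCoeff_zero fun i => by
      fin_cases i <;> simp [PowerSeries.constantCoeff_subst_eq_zero (MvPowerSeries.constantCoeff_X _) φ hφ]
  rw [homDefect, homDefect, map_sub, PowerSeries.map_subst hFs, MvPowerSeries.map_subst hpair, map_vec2,
    PowerSeries.map_subst h0, PowerSeries.map_subst h1]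
  simp only [MvPowerSeries.map_X]

/-- Base change of the additivity defect. [cite: Hazewinkel1978, §1.1 (1.1.6)] -/
theorem map_addDefect (f : B →+* B') {φ ψ χ : PowerSeries B} (hφ : PowerSeries.constantCoeff φ = 0)
    (hψ : PowerSeries.constantCoeff ψ = 0) :
    PowerSeries.map f (addDefect F φ ψ χ) =
      addDefect (MvPowerSeries.map f F) (PowerSeries.map f φ) (PowerSeries.map f ψ) (PowerSeries.map f χ) := by
  have hpair : HasSubst ![(φ : MvPowerSeries Unit B), ψ] :=
    hasSubst_pair (PowerSeries.HasSubst.of_constantCoeff_zero' hφ) (PowerSeries.HasSubst.of_constantCoeff_zero' hψ)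
  rw [addDefect, addDefect, map_sub]
  change _ - MvPowerSeries.map f (F.subst _) = _
  rw [MvPowerSeries.map_subst hpair, map_vec2]
  rfl

/-- Base change of the multiplicativity defect. [cite: Hazewinkel1978, §1.1 (1.1.6)] -/
theorem map_mulDefect (f : B →+* B') {φ ψ χ : PowerSeries B} (hψ : PowerSeries.constantCoeff ψ = 0) :
    PowerSeries.map f (mulDefect φ ψ χ) = mulDefect (PowerSeries.map f φ) (PowerSeries.map f ψ) (PowerSeries.map f χ) := by
  rw [mulDefect, mulDefect, map_sub]
  congr 1
  change MvPowerSeries.map f (PowerSeries.subst ψ φ) = _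
  rw [PowerSeries.map_subst (PowerSeries.HasSubst.of_constantCoeff_zero' hψ)]
  rfl

/-- The order does not drop under base change (restated for univariate series viewed as `MvPowerSeries Unit`). [folklore] -/
private theorem le_order_map' (f : B →+* B') (φ : PowerSeries B) :
    MvPowerSeries.order φ ≤ MvPowerSeries.order (PowerSeries.map f φ) :=
  MvPowerSeries.le_order_map f

/-- **Base change of buds**: if `(F, ρ)` is an `m`-bud over `B` and `f : B → B′` is an `𝒪`-algebra map, then
`(f_* F, f_* ∘ ρ)` is an `m`-bud over `B′`. [cite: Hazewinkel1978, §21.1 (21.1.4)] -/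
theorem IsOModuleBud.map (h : IsOModuleBud 𝒪 m F ρ) (f : B →ₐ[𝒪] B') :
    IsOModuleBud 𝒪 m (MvPowerSeries.map f.toRingHom F) (fun a => PowerSeries.map f.toRingHom (ρ a)) where
  constantCoeff_F := by rw [MvPowerSeries.constantCoeff_map, h.constantCoeff_F, map_zero]
  two_le_order_F := by
    have := MvPowerSeries.le_order_map f.toRingHom (φ := F - X 0 - X 1)
    rw [map_sub, map_sub, MvPowerSeries.map_X, MvPowerSeries.map_X] at this
    exact h.two_le_order_F.trans this
  constantCoeff_ρ := fun a => by
    rw [← PowerSeries.coeff_zero_eq_constantCoeff_apply, PowerSeries.coeff_map,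
      PowerSeries.coeff_zero_eq_constantCoeff_apply, h.constantCoeff_ρ, map_zero]
  coeff_one_ρ := fun a => by rw [PowerSeries.coeff_map, h.coeff_one_ρ]; exact f.commutes a
  assoc := by rw [← map_assocDefect _ h.constantCoeff_F]; exact h.assoc.trans (MvPowerSeries.le_order_map _)
  comm := by rw [← map_commDefect]; exact h.comm.trans (MvPowerSeries.le_order_map _)
  hom := fun a => by
    rw [← map_homDefect _ h.constantCoeff_F (h.constantCoeff_ρ a)]; exact (h.hom a).trans (MvPowerSeries.le_order_map _)
  add := fun a b => by
    rw [← map_addDefect _ (h.constantCoeff_ρ a) (h.constantCoeff_ρ b)]; exact (h.add a b).trans (le_order_map' _ _)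
  mul := fun a b => by
    rw [← map_mulDefect _ (h.constantCoeff_ρ b)]; exact (h.mul a b).trans (le_order_map' _ _)
  one := by
    have := le_order_map' f.toRingHom (ρ 1 - PowerSeries.X)
    rw [map_sub, PowerSeries.map_X] at this
    exact h.one.trans this
  zero := by
    have := le_order_map' f.toRingHom (ρ 0)
    exact h.zero.trans this

/-- The order is unchanged under an INJECTIVE base change. [folklore] -/
private theorem order_map_of_injective {τ : Type*} (f : B →+* B') (hf : Function.Injective f) (G : MvPowerSeries τ B) :
    (MvPowerSeries.map f G).order = G.order := by
  refine le_antisymm ?_ (MvPowerSeries.le_order_map f)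
  refine MvPowerSeries.le_order fun d hd => ?_
  have := MvPowerSeries.coeff_of_lt_order hd
  rw [MvPowerSeries.coeff_map] at this
  exact hf (by rw [this, map_zero])

/-- The order of a univariate series is unchanged under an injective base change. [folklore] -/
private theorem order_pmap_of_injective (f : B →+* B') (hf : Function.Injective f) (φ : PowerSeries B) :
    MvPowerSeries.order (PowerSeries.map f φ) = MvPowerSeries.order φ :=
  order_map_of_injective f hf φ

/-- **Bud-ness descends along injective base change**: if `f : B → B′` is an injective `𝒪`-algebra map, `F`, `ρ_a` have no
constant terms, `ρ_a ≡ a·X (mod deg 2)`, and `(f_* F, f_* ∘ ρ)` is an `m`-bud, then `(F, ρ)` is an `m`-bud.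
[cite: Lazard1955, §II (bourgeons)] -/
theorem IsOModuleBud.of_map_injective (f : B →ₐ[𝒪] B') (hf : Function.Injective f)
    (hF : MvPowerSeries.constantCoeff F = 0) (hρ0 : ∀ a, PowerSeries.constantCoeff (ρ a) = 0)
    (hρ1 : ∀ a, PowerSeries.coeff 1 (ρ a) = algebraMap 𝒪 B a)
    (h : IsOModuleBud 𝒪 m (MvPowerSeries.map f.toRingHom F) (fun a => PowerSeries.map f.toRingHom (ρ a))) :
    IsOModuleBud 𝒪 m F ρ where
  constantCoeff_F := hF
  two_le_order_F := by
    have := h.two_le_order_F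
    rwa [← MvPowerSeries.map_X (f := f.toRingHom) 0, ← MvPowerSeries.map_X (f := f.toRingHom) 1, ← map_sub, ← map_sub,
      order_map_of_injective _ hf] at this
  constantCoeff_ρ := hρ0
  coeff_one_ρ := hρ1
  assoc := by
    have := h.assoc
    rwa [← map_assocDefect _ hF, order_map_of_injective _ hf] at this
  comm := by
    have := h.comm
    rwa [← map_commDefect, order_map_of_injective _ hf] at this
  hom := fun a => by
    have := h.hom a
    rwa [← map_homDefect _ hF (hρ0 a), order_map_of_injective _ hf] at this
  add := fun a b => by
    have := h.add a b
    rwa [← map_addDefect _ (hρ0 a) (hρ0 b), order_pmap_of_injective _ hf] at this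
  mul := fun a b => by
    have := h.mul a b
    rwa [← map_mulDefect _ (hρ0 b), order_pmap_of_injective _ hf] at this
  one := by
    have := h.one
    rwa [← PowerSeries.map_X f.toRingHom, ← map_sub, order_pmap_of_injective _ hf] at this
  zero := by
    have := h.zero
    rwa [order_pmap_of_injective _ hf] at this

end Map

end Literature.RingTheory.FormalGroups
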